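import Summits.HodgeConjecture.HodgeConjecture.Theorems.MarkmanPartnerTransportPicardThreeK3SquaresZeta11Type
import Literature.AlgebraicGeometry.Surfaces.K3RealMultiplicationSqrt2OpenFamily
import HarnessLib

/-!
# Route MarkmanPartnerTransport · crux `PicardThreeK3Squares` (stmt-HodgeConjecture-19652) —
# HC⁴(S ⊗ S) for every K3 surface of the van Geemen–Schütt √2 real-multiplication type (ρ = 10)

Cell hodge-nonav, crux #4 (HC⁴(S ⊗ S) for projective K3 surfaces with `ρ(S) ≥ 3`; open core: real
multiplication), INDEX row M-θ√2 (planner memo ROUTE-P1AI §A.5): the van Geemen–Schütt √2 family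
(Forum Math. Sigma 13 (2025) e2, Thm. 1.2 (2), Prop. 6.2, §6.4, Rem. 6.5) has Picard number `10` —
INSIDE the crux's open Picard list `{4, 6, 7, 8, 10, 12, 13, 14, 16}`, and at a Picard number NOT
reached by the tree's √2 slice `Residue.picardThreeK3Squares_iff_residue_sqrtTwo` (`ρ ≥ 11`,
Nikulin-involution mechanism) — real multiplication by `ℚ(√2)` induced by a degree-`2` rational
self-map, and FOUR moduli (a maximal family). It is typed as the ∃-form open-period-set fact
`VanGeemenSchuett2025_sqrt2_cycleOnOpenPeriodSet` (`Literature/…/K3RealMultiplicationSqrt2OpenFamily`)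
and plugged into (T‴) `RMTypeOrbit.hodgeConjectureFor_square_of_exists_on_open_at_of_isK3Surface`
(prover seat hodge-nonav-19652-p1 gen 10: rational orbit density + Buskin transport). Prover seat
hodge-nonav-19652-p1 gen 12; `--supports stmt-HodgeConjecture-19652`, helper. CONDITIONAL on the two
named facts `Buskin2019_hodgeIsometry_algebraic` and `VanGeemenSchuett2025_sqrt2_cycleOnOpenPeriodSet`
ONLY; credits nothing; nothing here says HC is proved.

* `real_sqrt_two_ne_zero` — `√2 ≠ 0`.
* `hodgeConjectureFor_square_of_sqrt2Model_of_open` — (T‴) specialised to a √2 datum `θ` (rational,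
  `k3Form`-self-adjoint, kernel of rank `10`, `θ³ = 2θ`) GIVEN the open-set input for `θ` at `√2`
  (the reusable `∀`-datum form; mod Buskin only).
* **`exists_sqrt2Type_hodgeConjectureFor_square`** — THERE IS such a √2 datum `θ` (the marking
  transport of the cycle-induced endomorphism `(φ' ∘ ψ)^* ∘ π_T` of a very general member of the
  family) such that EVERY projective K3 surface `S` marked by `(η, p, x)` carrying an endomorphism
  `t` of `H²(S(ℂ); ℂ)` (rational, type-preserving, killing `N¹`, image `⊥ N¹`, `P(t) = 0` on `T` for
  a separable `P` with `P(0) ≠ 0`, generating `End_Hdg T(S)`) that is conjugate by a RATIONAL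
  ISOMETRY `σ` of `Λ_ℚ` to `θ_ℂ` satisfies `HodgeConjectureFor 4 (S ⊗ S)` — exactly the K3 surfaces
  RM-isogenous to a member of the family (`RMTypeOrbit.exists_isogenous_markedK3_mem_of_isOpen`), all
  of Picard number `10` with `End_Hdg T(S) = ℚ(√2)` for the very general ones. ONE rational type
  (no uniqueness among `ρ = 10`, `E ∋ √2` types is claimed).
* `exists_sqrt2Type_hodgeConjectureFor_hilbertSquare` — the same for every Hilbert square `S^{[2]}`
  (+ `Beauville1983_hilbertSquare_blowupDiagonal_surjection`).

No definition, no sorry.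

References: van Geemen–Schütt, Forum Math. Sigma 13 (2025) e2, Thm. 1.2 (2), §2.6, Prop. 6.2,
Rem. 6.3, §6.4, Rem. 6.5; Buskin, J. reine angew. Math. 755 (2019), Thm. 1.1; Huybrechts, *Lectures on
K3 Surfaces*, Ch. 3 Cor. 3.6, Ch. 6 Prop. 1.5, Ch. 7 Thm. 5.3.
-/

set_option linter.dupNamespace false

noncomputable section

namespace Summit.HodgeConjecture.HodgeConjecture.Theorems.MarkmanPartnerTransport.RMTypeOrbit

open CategoryTheory MonoidalCategory Polynomial
open Literature.AlgebraicGeometry Literature.AlgebraicGeometry.Motives Literature.AlgebraicGeometry.HodgeTheory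
open Literature.AlgebraicGeometry.Surfaces Literature.LinearAlgebra.QuadraticForm
open Literature.AlgebraicGeometry.Hyperkaehler Literature.AlgebraicGeometry.HilbertScheme
open Literature.AlgebraicTopology.SingularHomology
open Summit.HodgeConjecture.HodgeConjecture.Theorems.NikulinTwinTransport
open Summit.HodgeConjecture.HodgeConjecture.Theorems.MarkmanPartnerTransport.IsogenyInvariance
open Summit.HodgeConjecture.HodgeConjecture.Theorems.MarkmanPartnerTransport.RMTypeDescent

/-- `MarkedK3[S, η, p, x]`: VERBATIM the `let MarkedK3 := …` binder of the route declaration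
`PicardThreeK3Squares` (as in `…RMTypeDescent`). Local notation only. -/
local notation3 (prettyPrint := false) "MarkedK3[" S ", " η ", " p ", " x "]" =>
  (p ≠ 0 ∧ (IsIntegralClass p ∧
    (∀ q : complexBetti S (2 * 2), IsIntegralClass q → ∃ n : ℤ, q = n • p) ∧
    (∀ c : complexBetti S (2 * 1), IsIntegralClass c ↔ ∃ v : K3Index → ℤ, η c = fun i => (v i : ℂ)) ∧
    (∀ a b : complexBetti S (2 * 1),
      cupProduct (rfl : 2 * 1 + 2 * 1 = 2 * 2) a b = k3Form (η a) (η b) • p) ∧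
    IsOfHodgeType 2 S (2 * 1) 2 0 (LinearEquiv.symm η x) ∧
    (∀ τ : complexBetti S (2 * 1), IsOfHodgeType 2 S (2 * 1) 2 0 τ →
      ∃ t : ℂ, τ = t • LinearEquiv.symm η x)) ∧
    (k3Form x x = 0 ∧ 0 < (k3Form (star x) x).re ∧
      ∃ u : K3Index → ℤ, k3Form (fun i => (u i : ℂ)) x = 0 ∧ 0 < ∑ i, ∑ j, u i * k3Gram i j * u j))

/-- `Sqrt2Model[θ]`: VERBATIM the datum conjuncts of the named fact
`VanGeemenSchuett2025_sqrt2_cycleOnOpenPeriodSet` — `θ ∈ M₂₂(ℚ)` is `k3Form`-self-adjoint, its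
kernel has dimension `10` (Picard number `10`), and `θ_ℂ³ = 2θ_ℂ` (`θ² = 2` on `T = (ker θ)^⊥`).
Local notation only. -/
local notation3 (prettyPrint := false) "Sqrt2Model[" θ "]" =>
  ((∀ a b : K3Index → ℂ, k3Form (thetaC θ a) b = k3Form a (thetaC θ b)) ∧
    Module.finrank ℂ (LinearMap.ker (thetaC θ)) = 10 ∧
    thetaC θ ^ 3 = (2 : ℂ) • thetaC θ)

/-- `CycleEx[θ, e, U]`: the ∃-form cycle clause of (T‴) (`…RMTypeOpenSingleEigenvalue`) — at every
`θ`-generic period point of `D_{θ,e}` in `U` there EXISTS a marked projective K3 surface carrying an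
algebraic class inducing `η'⁻¹ θ_ℂ η'`. Local notation only. -/
local notation3 (prettyPrint := false) "CycleEx[" θ ", " e ", " U "]" =>
  (∀ y : K3Index → ℂ, y ∈ U → thetaC θ y = (e : ℂ) • y → k3Form y y = 0 → 0 < (k3Form (star y) y).re →
    (∀ v : K3Index → ℚ, k3Form (fun i => (v i : ℂ)) y = 0 → Matrix.mulVec θ v = 0) →
    ∃ (S' : SchemeOver ℂ) (hS' : IsK3Surface S') (η' : complexBetti S' (2 * 1) ≃ₗ[ℂ] (K3Index → ℂ))
      (p' : complexBetti S' (2 * 2)), MarkedK3[S', η', p', y] ∧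
      ∃ γ' ∈ algebraicClasses (S' ⊗ S') 2, ∀ z : complexBetti S' (2 * 1),
        (η'.symm.toLinearMap ∘ₗ (thetaC θ ∘ₗ η'.toLinearMap)) z =
          complexGysin complexOrientationFamily
            (IsSmoothProjective.tensor_holds hS'.isSmoothProjective hS'.isSmoothProjective)
            hS'.isSmoothProjective (SemiCartesianMonoidalCategory.fst S' S')
            (rfl : 2 * 1 + 2 * 2 + 2 * 2 = 2 * 1 + 2 * (2 + 2))
            (cupProduct (rfl : 2 * 1 + 2 * 2 = 2 * 1 + 2 * 2)
              (complexBetti.map (SemiCartesianMonoidalCategory.snd S' S') (2 * 1) z) γ'))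

/-- `SquareHC[θ]`: **every K3 surface of rational real-multiplication type `θ` has HC⁴(S ⊗ S)** —
VERBATIM the `S`-side binders and conclusion of (T‴)
`hodgeConjectureFor_square_of_exists_on_open_at_of_isK3Surface` (as in `…Zeta9Type`). Local notation
only. -/
local notation3 (prettyPrint := false) "SquareHC[" θ "]" =>
  (∀ (S : SchemeOver ℂ) (_hS : IsK3Surface S) (P : ℚ[X]) (_hPsep : P.Separable) (_hP0 : P.eval 0 ≠ 0)
    (η : complexBetti S (2 * 1) ≃ₗ[ℂ] (K3Index → ℂ)) (p : complexBetti S (2 * 2)) (x : K3Index → ℂ)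
    (_hM : MarkedK3[S, η, p, x])
    (t : complexBetti S (2 * 1) →ₗ[ℂ] complexBetti S (2 * 1))
    (_ht_rat : ∀ y, IsRationalClass y → IsRationalClass (t y))
    (_ht_typ : ∀ (i j : ℕ) (y : complexBetti S (2 * 1)),
      IsOfHodgeType 2 S (2 * 1) i j y → IsOfHodgeType 2 S (2 * 1) i j (t y))
    (_ht_N : ∀ d ∈ algebraicClasses S 1, t d = 0)
    (_ht_perp : ∀ (y : complexBetti S (2 * 1)), ∀ d ∈ algebraicClasses S 1,
      cupProduct (rfl : 2 * 1 + 2 * 1 = 2 * 2) (t y) d = 0)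
    (_hP : IsAnnihilatedOnTranscendentalBy S t P) (_hgen : TranscendentalEndomorphismsGeneratedBy S t)
    (σ : Module.End ℂ (K3Index → ℂ)) (_hσ : ∀ a b, k3Form (σ a) (σ b) = k3Form a b)
    (_hσrat : ∀ v : K3Index → ℤ, ∃ w : K3Index → ℚ, σ (fun i => (v i : ℂ)) = fun i => (w i : ℂ))
    (_hconj : ∀ c : complexBetti S (2 * 1), σ (η (t c)) = thetaC θ (σ (η c))),
    HodgeConjectureFor 4 (S ⊗ S))

variable {S : SchemeOver ℂ}

/-- `√2 ≠ 0`. [folklore] -/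
theorem real_sqrt_two_ne_zero : Real.sqrt 2 ≠ 0 :=
  (Real.sqrt_pos.mpr (by norm_num : (0 : ℝ) < 2)).ne'

/-- **(T‴) for a √2 datum, GIVEN the open-set input.** Let `θ ∈ M₂₂(ℚ)` be `k3Form`-self-adjoint
with kernel of rank `10` and `θ_ℂ³ = 2θ_ℂ`, and suppose `θ` is cycle-induced (∃-form) on an open
`U ⊂ Λ_ℂ` meeting the Hodge locus `D_{θ,√2}`. Then every marked projective K3 surface `(S, η, p, x)`
with an endomorphism `t` (rational, type-preserving, killing `N¹`, image `⊥ N¹`, `P(t) = 0` on `T`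
for a separable `P` with `P(0) ≠ 0`, generating `End_Hdg T(S)`) conjugate by a rational isometry `σ`
of `Λ_ℚ` to `θ_ℂ` satisfies `HodgeConjectureFor 4 (S ⊗ S)` —
`hodgeConjectureFor_square_of_exists_on_open_at_of_isK3Surface` with `e₀ = √2 ≠ 0`. No located
family is assumed here. CONDITIONAL on `Buskin2019_hodgeIsometry_algebraic` and the displayed open-set
input only; credits nothing. [cite: GeemenSchutt2023, §2.1, §3.4 and §6.4] [cite: Buskin2019, Thm. 1.1]
[cite: Huybrechts2016K3, Ch. 6 Prop. 1.5 and Ch. 14 §0.3 (vi)] -/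
theorem hodgeConjectureFor_square_of_sqrt2Model_of_open
    (hB : Buskin2019_hodgeIsometry_algebraic) {θ : Matrix K3Index K3Index ℚ} (hZ : Sqrt2Model[θ])
    {U : Set (K3Index → ℂ)} (hU : IsOpen U) {y₁ : K3Index → ℂ} (hy₁U : y₁ ∈ U)
    (hy₁ : thetaC θ y₁ = ((Real.sqrt 2 : ℝ) : ℂ) • y₁) (h₁₁ : k3Form y₁ y₁ = 0)
    (h₁p : 0 < (k3Form (star y₁) y₁).re) (hcyc : CycleEx[θ, (Real.sqrt 2 : ℝ), U])
    {S : SchemeOver ℂ} (hS : IsK3Surface S) {P : ℚ[X]} (hPsep : P.Separable) (hP0 : P.eval 0 ≠ 0)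
    (η : complexBetti S (2 * 1) ≃ₗ[ℂ] (K3Index → ℂ)) (p : complexBetti S (2 * 2)) (x : K3Index → ℂ)
    (hM : MarkedK3[S, η, p, x])
    (t : complexBetti S (2 * 1) →ₗ[ℂ] complexBetti S (2 * 1))
    (ht_rat : ∀ y, IsRationalClass y → IsRationalClass (t y))
    (ht_typ : ∀ (i j : ℕ) (y : complexBetti S (2 * 1)),
      IsOfHodgeType 2 S (2 * 1) i j y → IsOfHodgeType 2 S (2 * 1) i j (t y))
    (ht_N : ∀ d ∈ algebraicClasses S 1, t d = 0)
    (ht_perp : ∀ (y : complexBetti S (2 * 1)), ∀ d ∈ algebraicClasses S 1,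
      cupProduct (rfl : 2 * 1 + 2 * 1 = 2 * 2) (t y) d = 0)
    (hP : IsAnnihilatedOnTranscendentalBy S t P) (hgen : TranscendentalEndomorphismsGeneratedBy S t)
    (σ : Module.End ℂ (K3Index → ℂ)) (hσ : ∀ a b, k3Form (σ a) (σ b) = k3Form a b)
    (hσrat : ∀ v : K3Index → ℤ, ∃ w : K3Index → ℚ, σ (fun i => (v i : ℂ)) = fun i => (w i : ℂ))
    (hconj : ∀ c : complexBetti S (2 * 1), σ (η (t c)) = thetaC θ (σ (η c))) :
    HodgeConjectureFor 4 (S ⊗ S) := by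
  obtain ⟨hθsa, -, -⟩ := hZ
  exact hodgeConjectureFor_square_of_exists_on_open_at_of_isK3Surface hB hθsa real_sqrt_two_ne_zero hU
    hy₁U hy₁ h₁₁ h₁p hcyc hS hPsep hP0 η p x hM t ht_rat ht_typ ht_N ht_perp hP hgen σ hσ hσrat hconj

/-- **HC⁴(S ⊗ S) for every K3 surface of the van Geemen–Schütt √2 real-multiplication type (Picard
number `10`).** THERE IS a rational matrix `θ ∈ M₂₂(ℚ)`, `k3Form`-self-adjoint with kernel of rank
`10` and `θ_ℂ³ = 2θ_ℂ` — the marking transport `η₁ ((φ' ∘ ψ)^* ∘ π_T) η₁⁻¹` of the cycle-induced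
real-multiplication endomorphism of a very general member
`y² = x(x² + 2tα(t²)x + ½t²α(t²)² + tβ(t²))` of the family of Prop. 6.2 (2) (`φ' ∘ ψ` its degree-`2`
rational self-map, acting on `ω` by `√2`) — such that EVERY projective K3 surface `S`, marked by
`(η, p, x)` and carrying an endomorphism `t` of `H²(S(ℂ); ℂ)` — rational, Hodge-type preserving, killing
`N¹H²`, with image cup-orthogonal to `N¹H²`, annihilated on `T(S)` by a separable `P ∈ ℚ[X]` with
`P(0) ≠ 0`, and generating `End_Hdg T(S)` — which is conjugate to `θ_ℂ` by a RATIONAL ISOMETRY `σ` of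
`Λ_ℚ` (`σ(η(t c)) = θ_ℂ(σ(η c))`), satisfies `HodgeConjectureFor 4 (S ⊗ S)`. Proof: the fact supplies
`θ` together with an open `U ∋ y₁ ∈ D_{θ,√2}` and `CycleEx[θ, √2, U]`;
`hodgeConjectureFor_square_of_sqrt2Model_of_open` concludes. These `S` are exactly the K3 surfaces
RM-isogenous to a member of the √2 family (`RMTypeOrbit.exists_isogenous_markedK3_mem_of_isOpen`), all
of Picard number `10` — a rational real-multiplication type INSIDE the open Picard list of crux
`PicardThreeK3Squares` and below the reach (`ρ ≥ 11`) of `Residue.picardThreeK3Squares_iff_residue_sqrtTwo`.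
ONE rational type: no uniqueness among types with `ρ = 10`, `E ∋ √2` is claimed. CONDITIONAL on
`Buskin2019_hodgeIsometry_algebraic` and `VanGeemenSchuett2025_sqrt2_cycleOnOpenPeriodSet` ONLY;
credits nothing; HC is NOT proved here.
[cite: GeemenSchutt2023, Thm. 1.2 (2), Prop. 6.2, Rem. 6.3, §6.4, Rem. 6.5]
[cite: Buskin2019, Thm. 1.1] [cite: Huybrechts2016K3, Ch. 3 Cor. 3.6, Ch. 6 Prop. 1.5, Ch. 7 Thm. 5.3] -/
theorem exists_sqrt2Type_hodgeConjectureFor_square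
    (hB : Buskin2019_hodgeIsometry_algebraic) (hV : VanGeemenSchuett2025_sqrt2_cycleOnOpenPeriodSet) :
    ∃ θ : Matrix K3Index K3Index ℚ, Sqrt2Model[θ] ∧ SquareHC[θ] := by
  obtain ⟨θ, hsa, hfin, hcube, U, hU, ⟨y₁, hy₁U, hy₁, h₁₁, h₁p⟩, hcyc⟩ := hV
  refine ⟨θ, ⟨hsa, hfin, hcube⟩, ?_⟩
  intro S hS P hPsep hP0 η p x hM t ht_rat ht_typ ht_N ht_perp hP hgen σ hσ hσrat hconj
  exact hodgeConjectureFor_square_of_sqrt2Model_of_open hB ⟨hsa, hfin, hcube⟩ hU hy₁U hy₁ h₁₁ h₁p hcyc hS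
    hPsep hP0 η p x hM t ht_rat ht_typ ht_N ht_perp hP hgen σ hσ hσrat hconj

/-- **HC⁴ of every Hilbert square `S^{[2]}` of every K3 surface of the van Geemen–Schütt √2
real-multiplication type** (smooth projective fourfolds of K3^[2]-type with `ρ = 11`) — the datum of
`exists_sqrt2Type_hodgeConjectureFor_square` followed by `HC⁴(S × S) ⇒ HC⁴(S^{[2]})`: `S^{[2]}` is the
surjective image of the smooth blow-up of `S × S` along the diagonal
(`Beauville1983_hilbertSquare_blowupDiagonal_surjection`), so `hodgeConjectureFor_of_tower_surjective_le_five`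
(pull-back input discharged by `fulton1998_map_mem_algebraicClasses_holds`) applies. CONDITIONAL on
`Buskin2019_hodgeIsometry_algebraic`, `VanGeemenSchuett2025_sqrt2_cycleOnOpenPeriodSet` and
`Beauville1983_hilbertSquare_blowupDiagonal_surjection`; credits nothing; HC is NOT proved here.
[cite: GeemenSchutt2023, Thm. 1.2 (2), Prop. 6.2, §6.4] [cite: Beauville1983, §6 (e)–(f), p. 766]
[cite: Arapura2001HodgeCyclesModuli, Lemma 13 and Lemma 16] [cite: Buskin2019, Thm. 1.1] -/
theorem exists_sqrt2Type_hodgeConjectureFor_hilbertSquare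
    (hB : Buskin2019_hodgeIsometry_algebraic) (hV : VanGeemenSchuett2025_sqrt2_cycleOnOpenPeriodSet)
    (hBea : Beauville1983_hilbertSquare_blowupDiagonal_surjection) :
    ∃ θ : Matrix K3Index K3Index ℚ, Sqrt2Model[θ] ∧
      ∀ (S H : SchemeOver ℂ) (hS : IsK3Surface S) (Ξ : (S ⊗ H).left.IdealSheafData)
        (_hHilb : IsHilbertSchemeOfPoints 2 S H Ξ) (_hH : IsSmoothProjective 4 H)
        (P : ℚ[X]) (_hPsep : P.Separable) (_hP0 : P.eval 0 ≠ 0)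
        (η : complexBetti S (2 * 1) ≃ₗ[ℂ] (K3Index → ℂ)) (p : complexBetti S (2 * 2)) (x : K3Index → ℂ)
        (_hM : MarkedK3[S, η, p, x])
        (t : complexBetti S (2 * 1) →ₗ[ℂ] complexBetti S (2 * 1))
        (_ht_rat : ∀ y, IsRationalClass y → IsRationalClass (t y))
        (_ht_typ : ∀ (i j : ℕ) (y : complexBetti S (2 * 1)),
          IsOfHodgeType 2 S (2 * 1) i j y → IsOfHodgeType 2 S (2 * 1) i j (t y))
        (_ht_N : ∀ d ∈ algebraicClasses S 1, t d = 0)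
        (_ht_perp : ∀ (y : complexBetti S (2 * 1)), ∀ d ∈ algebraicClasses S 1,
          cupProduct (rfl : 2 * 1 + 2 * 1 = 2 * 2) (t y) d = 0)
        (_hP : IsAnnihilatedOnTranscendentalBy S t P) (_hgen : TranscendentalEndomorphismsGeneratedBy S t)
        (σ : Module.End ℂ (K3Index → ℂ)) (_hσ : ∀ a b, k3Form (σ a) (σ b) = k3Form a b)
        (_hσrat : ∀ v : K3Index → ℤ, ∃ w : K3Index → ℚ, σ (fun i => (v i : ℂ)) = fun i => (w i : ℂ))
        (_hconj : ∀ c : complexBetti S (2 * 1), σ (η (t c)) = thetaC θ (σ (η c))),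
        HodgeConjectureFor 4 H := by
  obtain ⟨θ, hZ, hsq⟩ := exists_sqrt2Type_hodgeConjectureFor_square hB hV
  refine ⟨θ, hZ, ?_⟩
  intro S H hS Ξ hHilb hH P hPsep hP0 η p x hM t ht_rat ht_typ ht_N ht_perp hP hgen σ hσ hσrat hconj
  have hS2 : IsSmoothProjective 2 S := hS.isSmoothProjective
  obtain ⟨B, b, ρ, hBl, hρs⟩ := hBea S hS2 H Ξ hHilb
  haveI := hρs
  exact hodgeConjectureFor_of_tower_surjective_le_five fulton1998_map_mem_algebraicClasses_holds (n := 4)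
    (by norm_num) (Relation.ReflTransGen.single (hBl.smoothBlowupStep (by norm_num))) hBl.top hH ρ
    (hsq S hS P hPsep hP0 η p x hM t ht_rat ht_typ ht_N ht_perp hP hgen σ hσ hσrat hconj)

end Summit.HodgeConjecture.HodgeConjecture.Theorems.MarkmanPartnerTransport.RMTypeOrbit

end
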